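import Summits.CriticalPhenomena.PercolationContinuityZ3.Theorems.PercNearOneGluingNoHeavyLowerTailPatternLightest
import HarnessLib

/-!
# `NoHeavyLowerTail` (stmt-CriticalPhenomena-4575) — ranked selection of the attached relay: bookkeeping

Support file (prover `prim-hp-8`, PL programme; `--supports stmt-CriticalPhenomena-4575`).  No definitions, no named facts, no sorries.

`μ` a finite measure on bond configurations of `Fin n`, relays `A`, observer `o`.  The ATTACHMENT PATTERN of `o` (as in the registered stub
`stub_patternLightest`) is `π⁰(ω) = A.filter (fun b => ω ∈ openConnIn ((↑A)ᶜ ∪ {b}) o b)`.  A RANKING is `r : Fin n → ℕ`, injective on `A`;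
the selection events are `Sel_b = {b ∈ π⁰ ∧ ∀ b' ∈ A, r b' < r b → b' ∉ π⁰}` ("`b` is the `r`-first attached relay").

* `sel_disjoint` — the selection events are pairwise disjoint;
* `exists_compatible_ranking` — every score `S : Fin n → ℝ` has an injective ranking listing higher scores first;
* `sum_sel_eq_sum_patterns` — `Σ_{b∈A} μ(Sel_b)·g b = Σ_{∅≠B⊆A} μ(π⁰ = B)·g (sel B)` for the `r`-argmin selection `sel`: the selection form of a
  pattern bound is the stub's pattern form.

Used by the coin reduction (`…CoinPatterns.lean`, `…CoinStubShape.lean`) and by the two-copy expansion (`…TwoCopyExpansion.lean`).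
-/

noncomputable section

namespace Summit.CriticalPhenomena.PercolationContinuityZ3.Theorems

namespace CoinReduction

open MeasureTheory Set Literature.Probability.LatticeModels Literature.Probability.Percolation
open scoped Classical BigOperators

variable {n : ℕ}

/-- The selection events of distinct relays are disjoint (the ranking is injective on `A`). [folklore] -/
theorem sel_disjoint (A : Finset (Fin n)) (r : Fin n → ℕ) (hr : Set.InjOn r ↑A) (o : Fin n) {b₁ b₂ : Fin n}
    (h₁ : b₁ ∈ A) (h₂ : b₂ ∈ A) (hne : b₁ ≠ b₂) :
    Disjoint {ω : BondConfig (Fin n) |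
        b₁ ∈ (A.filter fun b' => ω ∈ openConnIn ((↑A : Set (Fin n))ᶜ ∪ {b'}) o b') ∧
        ∀ b' ∈ A, r b' < r b₁ → b' ∉ (A.filter fun b'' => ω ∈ openConnIn ((↑A : Set (Fin n))ᶜ ∪ {b''}) o b'')}
      {ω : BondConfig (Fin n) |
        b₂ ∈ (A.filter fun b' => ω ∈ openConnIn ((↑A : Set (Fin n))ᶜ ∪ {b'}) o b') ∧
        ∀ b' ∈ A, r b' < r b₂ → b' ∉ (A.filter fun b'' => ω ∈ openConnIn ((↑A : Set (Fin n))ᶜ ∪ {b''}) o b'')} := by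
  rw [Set.disjoint_left]
  rintro ω ⟨hb₁, hall₁⟩ ⟨hb₂, hall₂⟩
  have hr12 : r b₁ ≠ r b₂ := fun h => hne (hr (Finset.mem_coe.2 h₁) (Finset.mem_coe.2 h₂) h)
  rcases lt_or_gt_of_ne hr12 with h | h
  · exact hall₂ b₁ h₁ h hb₁
  · exact hall₁ b₂ h₂ h hb₂

/-- **A ranking compatible with a score.**  For every `S : Fin n → ℝ` and `A` there is `r : Fin n → ℕ`, injective on `A`, such that
`r b < r b'` implies `S b' ≤ S b` on `A` (rank = number of elements of `A` that are strictly better in the lexicographic order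
"larger score, then smaller index"). [folklore] -/
theorem exists_compatible_ranking (S : Fin n → ℝ) (A : Finset (Fin n)) :
    ∃ r : Fin n → ℕ, Set.InjOn r ↑A ∧ ∀ b ∈ A, ∀ b' ∈ A, r b < r b' → S b' ≤ S b := by
  set better : Fin n → Fin n → Prop := fun b b'' => S b < S b'' ∨ (S b'' = S b ∧ b'' < b) with hbetter
  set r : Fin n → ℕ := fun b => (A.filter fun b'' => better b b'').card with hr
  -- transitivity-type facts
  have hsub : ∀ b b' : Fin n, better b b' → (A.filter fun b'' => better b' b'') ⊆ A.filter fun b'' => better b b'' := by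
    intro b b' hbb' b'' hb''
    rw [Finset.mem_filter] at hb'' ⊢
    refine ⟨hb''.1, ?_⟩
    rcases hbb' with h1 | ⟨h1, h2⟩
    · rcases hb''.2 with h3 | ⟨h3, _⟩
      · exact Or.inl (lt_trans h1 h3)
      · exact Or.inl (h3 ▸ h1)
    · rcases hb''.2 with h3 | ⟨h3, h4⟩
      · exact Or.inl (h1 ▸ h3)
      · exact Or.inr ⟨h3.trans h1, lt_trans h4 h2⟩
  have hirr : ∀ b : Fin n, ¬ better b b := by
    intro b h
    rcases h with h | ⟨_, h⟩
    · exact lt_irrefl _ h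
    · exact lt_irrefl _ h
  have hlt_of : ∀ b ∈ A, ∀ b' ∈ A, better b b' → r b' < r b := by
    intro b _ b' hb'A hbb'
    apply Finset.card_lt_card
    refine (Finset.ssubset_iff_of_subset (hsub b b' hbb')).2 ⟨b', Finset.mem_filter.2 ⟨hb'A, hbb'⟩, ?_⟩
    intro h
    exact hirr b' (Finset.mem_filter.1 h).2
  have htot : ∀ b b' : Fin n, b ≠ b' → better b b' ∨ better b' b := by
    intro b b' hne
    rcases lt_trichotomy (S b) (S b') with h | h | h
    · exact Or.inl (Or.inl h)
    · rcases lt_or_gt_of_ne hne with h' | h'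
      · exact Or.inr (Or.inr ⟨h, h'⟩)
      · exact Or.inl (Or.inr ⟨h.symm, h'⟩)
    · exact Or.inr (Or.inl h)
  refine ⟨r, ?_, ?_⟩
  · intro b hb b' hb' hrr
    by_contra hne
    rcases htot b b' hne with h | h
    · exact absurd hrr (ne_of_gt (hlt_of b (Finset.mem_coe.1 hb) b' (Finset.mem_coe.1 hb') h))
    · exact absurd hrr (ne_of_lt (hlt_of b' (Finset.mem_coe.1 hb') b (Finset.mem_coe.1 hb) h))
  · intro b hb b' hb' hrr
    by_contra hS
    push Not at hS
    exact absurd hrr (not_lt.2 (le_of_lt (hlt_of b hb b' hb' (Or.inl hS))))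

/-- **Selection form = pattern form.**  For `r` injective on `A` and the `r`-argmin selection `sel` (`sel B ∈ B` and
`r (sel B) ≤ r b` for `b ∈ B`, whenever `B ≠ ∅`), and any `g`:
`Σ_{b∈A} μ(Sel_b)·g b = Σ_{∅ ≠ B ⊆ A} μ(π⁰ = B)·g (sel B)`. [folklore] -/
theorem sum_sel_eq_sum_patterns (μ : Measure (BondConfig (Fin n))) [IsFiniteMeasure μ] (A : Finset (Fin n)) (o : Fin n)
    (r : Fin n → ℕ) (hr : Set.InjOn r ↑A) (sel : Finset (Fin n) → Fin n)
    (hsel : ∀ B : Finset (Fin n), B.Nonempty → sel B ∈ B ∧ ∀ b ∈ B, r (sel B) ≤ r b) (g : Fin n → ℝ) :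
    ∑ b ∈ A, μ.real {ω : BondConfig (Fin n) |
        b ∈ (A.filter fun b' => ω ∈ openConnIn ((↑A : Set (Fin n))ᶜ ∪ {b'}) o b') ∧
        ∀ b' ∈ A, r b' < r b → b' ∉ (A.filter fun b'' => ω ∈ openConnIn ((↑A : Set (Fin n))ᶜ ∪ {b''}) o b'')} * g b =
      ∑ B ∈ A.powerset.erase ∅, μ.real {ω : BondConfig (Fin n) |
        (A.filter fun b' => ω ∈ openConnIn ((↑A : Set (Fin n))ᶜ ∪ {b'}) o b') = B} * g (sel B) := by
  set pat : BondConfig (Fin n) → Finset (Fin n) :=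
    fun ω => A.filter fun b' => ω ∈ openConnIn ((↑A : Set (Fin n))ᶜ ∪ {b'}) o b' with hpat
  set Sel : Fin n → Set (BondConfig (Fin n)) := fun b => {ω | b ∈ pat ω ∧ ∀ b' ∈ A, r b' < r b → b' ∉ pat ω} with hSel
  set P := A.powerset.erase ∅ with hP
  have hmeas : ∀ T : Set (BondConfig (Fin n)), MeasurableSet T := fun T => (Set.toFinite T).measurableSet
  have hmaps : ∀ B ∈ P, sel B ∈ A := by
    intro B hB
    have hBA : B ⊆ A := Finset.mem_powerset.1 (Finset.mem_of_mem_erase hB)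
    have hBne : B.Nonempty := Finset.nonempty_iff_ne_empty.2 (Finset.ne_of_mem_erase hB)
    exact hBA (hsel B hBne).1
  -- the fibre decomposition of Sel b
  have hfib : ∀ b ∈ A, μ.real (Sel b) = ∑ B ∈ P.filter (fun B => sel B = b), μ.real {ω | pat ω = B} := by
    intro b hbA
    have hdisj : (↑(P.filter fun B => sel B = b) : Set (Finset (Fin n))).PairwiseDisjoint
        fun B => ({ω | pat ω = B} : Set (BondConfig (Fin n))) := by
      intro B₁ _ B₂ _ hne
      rw [Function.onFun, Set.disjoint_left]
      intro ω h1 h2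
      exact hne (h1.symm.trans h2)
    rw [← measureReal_biUnion_finset hdisj (fun B _ => hmeas _)]
    congr 1
    ext ω
    simp only [hSel, mem_setOf_eq, mem_iUnion, Finset.mem_filter, exists_prop]
    constructor
    · rintro ⟨hb, hall⟩
      have hne : (pat ω).Nonempty := ⟨b, hb⟩
      have hPm : pat ω ∈ P := by
        refine Finset.mem_erase.2 ⟨Finset.nonempty_iff_ne_empty.1 hne, Finset.mem_powerset.2 ?_⟩
        intro x hx; exact (Finset.mem_filter.1 hx).1
      refine ⟨pat ω, ⟨hPm, ?_⟩, rfl⟩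
      obtain ⟨hs1, hs2⟩ := hsel (pat ω) hne
      have hsA : sel (pat ω) ∈ A := (Finset.mem_filter.1 hs1).1
      have h1 : r (sel (pat ω)) ≤ r b := hs2 b hb
      have h2 : ¬ r (sel (pat ω)) < r b := fun h => hall _ hsA h hs1
      exact hr (Finset.mem_coe.2 hsA) (Finset.mem_coe.2 hbA) (le_antisymm h1 (not_lt.1 h2))
    · rintro ⟨B, ⟨hBP, hselB⟩, hpatB⟩
      have hBne : B.Nonempty := Finset.nonempty_iff_ne_empty.2 (Finset.ne_of_mem_erase hBP)
      obtain ⟨hs1, hs2⟩ := hsel B hBne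
      rw [hselB] at hs1 hs2
      refine ⟨hpatB ▸ hs1, fun b' _ hlt hb' => ?_⟩
      rw [hpatB] at hb'
      exact absurd (hs2 b' hb') (not_le.2 hlt)
  calc ∑ b ∈ A, μ.real (Sel b) * g b
      = ∑ b ∈ A, ∑ B ∈ P.filter (fun B => sel B = b), μ.real {ω | pat ω = B} * g b := by
        apply Finset.sum_congr rfl
        intro b hb
        rw [hfib b hb, Finset.sum_mul]
    _ = ∑ b ∈ A, ∑ B ∈ P.filter (fun B => sel B = b), μ.real {ω | pat ω = B} * g (sel B) := by
        apply Finset.sum_congr rfl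
        intro b _
        apply Finset.sum_congr rfl
        intro B hB
        rw [(Finset.mem_filter.1 hB).2]
    _ = ∑ B ∈ P, μ.real {ω | pat ω = B} * g (sel B) :=
        Finset.sum_fiberwise_of_maps_to (g := sel) (fun B hB => hmaps B hB) _


end CoinReduction

end Summit.CriticalPhenomena.PercolationContinuityZ3.Theorems

end
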